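import Summits.Ventures.YMGap.Thresholds.OneLinkEigenCalculus
import HarnessLib

/-!
# Venture YMGap — the one-link modulus beyond first order, part 1: the degree-2 Casimir algebra on `SU(N)`
# and the closed-form SECOND-ORDER Poisson solution

HONEST FRAMING: venture file of the cell `pub-ymgap` (QuantumFields programme), strong-coupling LATTICE bookkeeping for
`SU(N)` lattice Yang–Mills; nothing about the continuum or the mass gap in the Clay sense.  This file is pure matrix
calculus (no measure, no number of record): it is the foundation («F1» of the cell note `HOME/p2/ONE-LINK-HIERARCHY.md`) of
the second-order Laplacian-eigenfunction expansion of the one-link Kantorovich–Rubinstein modulus, whose first order is the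
tree's `OneLinkEigenCalculus` / `OneLinkEigenModulus` (`oneLinkKRModulus_eigen`, `oneLinkKRModulus_refined`).

WHAT.  For the quadratic trace polynomials `w(Q) = Re tr(Q M₁ Q M₂)`, `t(Q) = Re(tr(Q M₁) tr(Q M₂))`,
`s(Q) = Re(tr(Q M₁) conj tr(Q M₂))` on `M_N(ℂ)` and the Laplace–Beltrami operator `Δ = ∑_α D_α²` of the tree's ambient
calculus (`SUNBakryEmeryPoincare`: `matD`, Parseval frame `frame`, `Lap`, `Gam`, `pot`):
* `matD_reTrQuad`: `D_A Re tr(Q M₁ Q M₂) = Re tr(Q A M₁ Q M₂) + Re tr(Q M₁ Q A M₂)`;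
* `Lap_reTrQuad`, `Lap_reTrProd`: `Δ w = −(2N − 4/N) w − 2 t`, `Δ t = −(2N − 4/N) t − 2 w` — i.e. `w ± t` are eigenfunctions
  with the Casimirs `2N ± 2 − 4/N` of `Sym²`/`Λ²` (the tree's `N − 1/N` is the fundamental) — from the two frame identities
  `∑_α Y_α X Y_α = −tr X · 1 + X/N` (`sum_frame_mul_mul_frame`) and `∑_α Y_α² = −(N − 1/N) 1`;
* `Lap_reTrProdConj`: `Δ s = −2N s + 2 Re tr(M₁ Q Qᴴ M₂ᴴ)` (adjoint Casimir `2N`; the last term is constant on `SU(N)`);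
* `lap_psiTwo_add_gam` (THE POISSON IDENTITY OF ORDER TWO): on `SU(N)`, `N ≥ 3`,
  `Δ ψ₂ + N Γ(Re tr(· B), Re tr(· Δ)) = ((N − 1/N)/2) Re tr(B Δᴴ)` (a constant) for the explicit quadratic polynomial
  `ψ₂ = −κ_w Re tr(Q Δ Q B) + κ_t Re(tr(QB) tr(QΔ)) − (1/(4N)) Re(tr(QB) conj tr(QΔ))`, `κ_w = N²/(4(N²−4))`,
  `κ_t = N/(2(N²−4))`.  Consequence (next file): with `u = Re tr(· Δ)`, `S = N Re tr(· B)`, `λ₁ = N − 1/N`,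
  `u = (−L_S (u + ψ₂) + N Γ(Re tr(· B), ψ₂) + const)/λ₁`, so the covariance of any observable with `u` under the one-link
  measure `ν_B` is an integration-by-parts term plus `N Cov(φ, Γ(pot B, ψ₂))` with a CUBIC remainder — Bakry–Émery is
  then needed only at third order (cell note §3–§5: `K₂(N, 0.19) ≈ 1.1` at large `N` versus `K_ref ≈ 2.1`).
Every identity of this file was checked numerically (finite differences on `SU(3…6)`, cell folder `HOME/p2/hier/alg_check.py`,
residuals ≤ 2e-8) before being proved here.

References: T. Bröcker, T. tom Dieck, GTM 98 (1985), IV (3.1) and §II.5 (Casimir eigenvalues of `Sym²`, `Λ²`, adjoint);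
H. Shen, R. Zhu, X. Zhu, CMP 400 (2023) 805–851, §4.1 (the one-link generator); cell notes `HOME/p2/ONE-LINK-MODULUS.md` §5,
`HOME/p2/ONE-LINK-HIERARCHY.md` §2–§3.
-/

noncomputable section

open scoped Matrix ComplexConjugate BigOperators RightActions
open Matrix Complex Finset
open Literature.MathematicalPhysics.QuantumFieldTheory
open Literature.MathematicalPhysics.QuantumFieldTheory.SUNBakryEmery

namespace Summit.Ventures.YMGap.OneLinkEigen

variable {N : ℕ}

/-! ### Frame sums against quadratic words -/

/-- `∑_α Re tr(P Y_α² R) = −(N − 1/N) Re tr(P R)` (Casimir of the fundamental). [folklore] -/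
theorem sum_re_trace_frame_sq (hN : N ≠ 0) (P R : Matrix (Fin N) (Fin N) ℂ) :
    ∑ α, (P * (frame α * frame α) * R).trace.re = -(((N : ℝ) - 1 / N) * (P * R).trace.re) := by
  rw [← Complex.re_sum, ← trace_sum, ← sum_mul, ← Matrix.mul_sum, sum_frame_mul_frame hN]
  have hc : ((N : ℂ) - 1 / N) = (((N : ℝ) - 1 / N : ℝ) : ℂ) := by push_cast; rfl
  rw [hc, Matrix.mul_neg, Matrix.neg_mul, trace_neg, Matrix.mul_smul, Matrix.smul_mul, trace_smul, Matrix.mul_one,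
    Complex.neg_re, smul_eq_mul, Complex.re_ofReal_mul]

/-- `∑_α Re tr(P Y_α X Y_α R) = −Re(tr X · tr(P R)) + (1/N) Re tr(P X R)` (the identity
`∑_α Y_α X Y_α = −tr X · 1 + X/N`). [folklore] -/
theorem sum_re_trace_frame_sandwich (hN : N ≠ 0) (P X R : Matrix (Fin N) (Fin N) ℂ) :
    ∑ α, (P * (frame α * X * frame α) * R).trace.re =
      -((X.trace * (P * R).trace).re) + (1 / N) * (P * X * R).trace.re := by
  rw [← Complex.re_sum, ← trace_sum, ← sum_mul, ← Matrix.mul_sum, sum_frame_mul_mul_frame hN]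
  have hc : (1 / N : ℂ) = ((1 / N : ℝ) : ℂ) := by push_cast; rfl
  rw [hc, Matrix.mul_add, Matrix.add_mul, trace_add, Matrix.mul_neg, Matrix.neg_mul, trace_neg, Matrix.mul_smul,
    Matrix.smul_mul, trace_smul, Matrix.mul_one, Matrix.mul_smul, Matrix.smul_mul, trace_smul, smul_eq_mul, smul_eq_mul,
    Complex.add_re, Complex.neg_re, Complex.re_ofReal_mul, Matrix.mul_assoc P X R]

section Calc

open scoped Matrix.Norms.Frobenius ContDiff Topology


/-! ### The quadratic word `Q ↦ Re tr(Q M₁ Q M₂)`: smoothness, derivative, Laplacian -/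

/-- `Q ↦ Re tr(Q M₁ Q M₂)` is smooth. [folklore] -/
theorem contDiff_reTrQuad (M₁ M₂ : Matrix (Fin N) (Fin N) ℂ) :
    ContDiff ℝ ∞ fun Q : Matrix (Fin N) (Fin N) ℂ => (Q * M₁ * Q * M₂).trace.re := by
  have h : ContDiff ℝ ∞ fun Q : Matrix (Fin N) (Fin N) ℂ => Q * M₁ * Q := (contDiff_id.mul contDiff_const).mul contDiff_id
  exact (reTrMul M₂).contDiff.comp h

/-- **`D_A Re tr(Q M₁ Q M₂) = Re tr(Q A M₁ Q M₂) + Re tr(Q M₁ Q A M₂)`** (Leibniz rule for the bilinear word).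
[folklore] -/
theorem matD_reTrQuad (A M₁ M₂ : Matrix (Fin N) (Fin N) ℂ) :
    matD A (fun Q : Matrix (Fin N) (Fin N) ℂ => (Q * M₁ * Q * M₂).trace.re) =
      fun Q => (Q * A * M₁ * Q * M₂).trace.re + (Q * M₁ * Q * A * M₂).trace.re := by
  funext Q
  have h1 : HasFDerivAt (fun Q : Matrix (Fin N) (Fin N) ℂ => Q * M₁)
      (ContinuousLinearMap.mulLeftRight ℝ (Matrix (Fin N) (Fin N) ℂ) 1 M₁) Q := hasFDerivAt_mul_const M₁ Q
  have h2 : HasFDerivAt (fun Q : Matrix (Fin N) (Fin N) ℂ => Q * 1)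
      (ContinuousLinearMap.mulLeftRight ℝ (Matrix (Fin N) (Fin N) ℂ) 1 1) Q := hasFDerivAt_mul_const 1 Q
  have h3 := ((reTrMul M₂).hasFDerivAt).comp Q (h1.mul' h2)
  have hf : (fun Q : Matrix (Fin N) (Fin N) ℂ => (Q * M₁ * Q * M₂).trace.re) =
      (reTrMul M₂ : Matrix (Fin N) (Fin N) ℂ → ℝ) ∘ ((fun Q : Matrix (Fin N) (Fin N) ℂ => Q * M₁) * fun Q => Q * 1) := by
    funext Q; simp [reTrMul_apply, Matrix.mul_assoc]
  rw [matD_apply, hf, h3.fderiv]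
  simp [reTrMul_apply, Matrix.mul_assoc]
  ring

/-- The second derivative of the quadratic word along a frame vector. [folklore] -/
theorem matD_matD_reTrQuad (Y M₁ M₂ : Matrix (Fin N) (Fin N) ℂ) (Q : Matrix (Fin N) (Fin N) ℂ) :
    matD Y (matD Y (fun Q : Matrix (Fin N) (Fin N) ℂ => (Q * M₁ * Q * M₂).trace.re)) Q =
      (Q * (Y * Y) * (M₁ * Q * M₂)).trace.re + 2 * (Q * (Y * (M₁ * Q) * Y) * M₂).trace.re
        + (Q * M₁ * Q * (Y * Y) * M₂).trace.re := by
  rw [matD_reTrQuad]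
  have e1 : (fun Q : Matrix (Fin N) (Fin N) ℂ => (Q * Y * M₁ * Q * M₂).trace.re + (Q * M₁ * Q * Y * M₂).trace.re)
      = (fun Q : Matrix (Fin N) (Fin N) ℂ => (Q * (Y * M₁) * Q * M₂).trace.re) +
        fun Q : Matrix (Fin N) (Fin N) ℂ => (Q * M₁ * Q * (Y * M₂)).trace.re := by
    funext Q; simp only [Pi.add_apply, Matrix.mul_assoc]
  rw [e1, matD_add (contDiff_reTrQuad _ _) (contDiff_reTrQuad _ _), Pi.add_apply, matD_reTrQuad, matD_reTrQuad]
  simp only [Matrix.mul_assoc]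
  ring

/-- **Casimir action on the quadratic word**: `Δ Re tr(Q M₁ Q M₂) = −(2N − 4/N) Re tr(Q M₁ Q M₂) − 2 Re(tr(Q M₁) tr(Q M₂))`
(so `w ± t` lie in `Sym²`/`Λ²` with Casimirs `2N ± 2 − 4/N`). [folklore] -/
theorem Lap_reTrQuad (hN : N ≠ 0) (M₁ M₂ : Matrix (Fin N) (Fin N) ℂ) :
    Lap (fun Q : Matrix (Fin N) (Fin N) ℂ => (Q * M₁ * Q * M₂).trace.re) = fun Q =>
      -((2 * (N : ℝ) - 4 / N) * (Q * M₁ * Q * M₂).trace.re) - 2 * ((Q * M₁).trace * (Q * M₂).trace).re := by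
  funext Q
  show ∑ α, matD (frame α) (matD (frame α) (fun Q : Matrix (Fin N) (Fin N) ℂ => (Q * M₁ * Q * M₂).trace.re)) Q = _
  simp_rw [matD_matD_reTrQuad]
  rw [sum_add_distrib, sum_add_distrib, ← mul_sum, sum_re_trace_frame_sq hN, sum_re_trace_frame_sandwich hN,
    sum_re_trace_frame_sq hN]
  have e1 : (M₁ * Q).trace = (Q * M₁).trace := trace_mul_comm _ _
  have e2 : (Q * (M₁ * Q * M₂)).trace.re = (Q * M₁ * Q * M₂).trace.re := by simp only [Matrix.mul_assoc]
  have e3 : (Q * (M₁ * Q) * M₂).trace.re = (Q * M₁ * Q * M₂).trace.re := by simp only [Matrix.mul_assoc]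
  rw [e1, e2, e3]
  ring

/-! ### The products `Re(tr(Q M₁) tr(Q M₂))` and `Re(tr(Q M₁) conj tr(Q M₂))` -/

/-- `Re tr(Q (−i M)) = Im tr(Q M)`. [folklore] -/
theorem re_trace_mul_negI_smul (Q M : Matrix (Fin N) (Fin N) ℂ) :
    (Q * ((-I) • M)).trace.re = (Q * M).trace.im := by
  rw [Matrix.mul_smul, trace_smul, smul_eq_mul, mul_re, neg_re, neg_im, I_re, I_im]
  ring

/-- `Re(tr(Q M₁) tr(Q M₂))` as a difference of products of the tree's linear potentials. [folklore] -/
theorem reTrProd_eq (M₁ M₂ : Matrix (Fin N) (Fin N) ℂ) :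
    (fun Q : Matrix (Fin N) (Fin N) ℂ => ((Q * M₁).trace * (Q * M₂).trace).re) =
      pot 1 M₁ * pot 1 M₂ - pot 1 ((-I) • M₁) * pot 1 ((-I) • M₂) := by
  funext Q
  simp only [Pi.sub_apply, Pi.mul_apply, pot, one_mul, re_trace_mul_negI_smul, mul_re]

/-- `Re(tr(Q M₁) conj tr(Q M₂))` as a sum of products of the tree's linear potentials. [folklore] -/
theorem reTrProdConj_eq (M₁ M₂ : Matrix (Fin N) (Fin N) ℂ) :
    (fun Q : Matrix (Fin N) (Fin N) ℂ => ((Q * M₁).trace * (starRingEnd ℂ) (Q * M₂).trace).re) =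
      pot 1 M₁ * pot 1 M₂ + pot 1 ((-I) • M₁) * pot 1 ((-I) • M₂) := by
  funext Q
  simp only [Pi.add_apply, Pi.mul_apply, pot, one_mul, re_trace_mul_negI_smul, mul_re, conj_re, conj_im]
  ring

/-- `Q ↦ Re(tr(Q M₁) tr(Q M₂))` is smooth. [folklore] -/
theorem contDiff_reTrProd (M₁ M₂ : Matrix (Fin N) (Fin N) ℂ) :
    ContDiff ℝ ∞ fun Q : Matrix (Fin N) (Fin N) ℂ => ((Q * M₁).trace * (Q * M₂).trace).re := by
  rw [reTrProd_eq]
  exact ((contDiff_pot 1 M₁).mul (contDiff_pot 1 M₂)).sub ((contDiff_pot 1 _).mul (contDiff_pot 1 _))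

/-- `Q ↦ Re(tr(Q M₁) conj tr(Q M₂))` is smooth. [folklore] -/
theorem contDiff_reTrProdConj (M₁ M₂ : Matrix (Fin N) (Fin N) ℂ) :
    ContDiff ℝ ∞ fun Q : Matrix (Fin N) (Fin N) ℂ => ((Q * M₁).trace * (starRingEnd ℂ) (Q * M₂).trace).re := by
  rw [reTrProdConj_eq]
  exact ((contDiff_pot 1 M₁).mul (contDiff_pot 1 M₂)).add ((contDiff_pot 1 _).mul (contDiff_pot 1 _))

/-- The carré du champ of the rotated potentials: `Γ(Re tr(·(−iM₁)), Re tr(·(−iM₂)))(Q) =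
½ Re tr(M₁QM₂Q) + ½ Re tr(M₁Q(M₂Q)ᴴ) − (1/N) Re tr(M₁Q) Re tr(M₂Q)`. [folklore] -/
theorem Gam_pot_negI_negI (hN : N ≠ 0) (M₁ M₂ Q : Matrix (Fin N) (Fin N) ℂ) :
    Gam (pot 1 ((-I) • M₁)) (pot 1 ((-I) • M₂)) Q =
      (1 / 2) * (M₁ * Q * M₂ * Q).trace.re + (1 / 2) * (M₁ * Q * (M₂ * Q)ᴴ).trace.re
        - (1 / N) * (M₁ * Q).trace.re * (M₂ * Q).trace.re := by
  rw [Gam_pot_pot hN]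
  have hI : (-I) * (-I) = (-1 : ℂ) := by rw [neg_mul_neg, I_mul_I]
  have hI' : (starRingEnd ℂ) (-I) * (-I) = (1 : ℂ) := by rw [map_neg, conj_I, neg_neg, mul_neg, I_mul_I, neg_neg]
  have h1 : ((-I) • M₁ * Q * ((-I) • M₂) * Q).trace.re = -(M₁ * Q * M₂ * Q).trace.re := by
    simp only [Matrix.smul_mul, Matrix.mul_smul, smul_smul, trace_smul, smul_eq_mul, hI]
    simp
  have h2 : ((-I) • M₁ * Q * ((-I) • M₂ * Q)ᴴ).trace.re = (M₁ * Q * (M₂ * Q)ᴴ).trace.re := by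
    simp only [Matrix.smul_mul, Matrix.mul_smul, conjTranspose_smul, smul_smul, trace_smul, smul_eq_mul, star_def]
    rw [hI', one_mul]
  have h3 : ∀ M : Matrix (Fin N) (Fin N) ℂ, ((-I) • M * Q).trace.im = -(M * Q).trace.re := by
    intro M
    rw [Matrix.smul_mul, trace_smul, smul_eq_mul, mul_im, neg_re, neg_im, I_re, I_im]
    ring
  rw [h1, h2, h3, h3]
  ring

/-- **Casimir action on the product**: `Δ Re(tr(Q M₁) tr(Q M₂)) = −(2N − 4/N) Re(tr(Q M₁) tr(Q M₂)) − 2 Re tr(Q M₁ Q M₂)`.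
[folklore] -/
theorem Lap_reTrProd (hN : N ≠ 0) (M₁ M₂ : Matrix (Fin N) (Fin N) ℂ) :
    Lap (fun Q : Matrix (Fin N) (Fin N) ℂ => ((Q * M₁).trace * (Q * M₂).trace).re) = fun Q =>
      -((2 * (N : ℝ) - 4 / N) * ((Q * M₁).trace * (Q * M₂).trace).re) - 2 * (Q * M₁ * Q * M₂).trace.re := by
  have hsub : (fun Q : Matrix (Fin N) (Fin N) ℂ => ((Q * M₁).trace * (Q * M₂).trace).re) =
      pot 1 M₁ * pot 1 M₂ + (-1 : ℝ) • (pot 1 ((-I) • M₁) * pot 1 ((-I) • M₂)) := by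
    rw [reTrProd_eq]; ext Q; simp; ring
  have hA : ContDiff ℝ ∞ (pot 1 M₁ * pot 1 M₂) := (contDiff_pot 1 M₁).mul (contDiff_pot 1 M₂)
  have hB : ContDiff ℝ ∞ (pot 1 ((-I) • M₁) * pot 1 ((-I) • M₂)) := (contDiff_pot 1 _).mul (contDiff_pot 1 _)
  have hB' : ContDiff ℝ ∞ ((-1 : ℝ) • (pot 1 ((-I) • M₁) * pot 1 ((-I) • M₂))) := by
    have h := hB.const_smul (-1 : ℝ); exact h
  rw [hsub, Lap_add hA hB', Lap_smul _ hB]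
  funext Q
  simp only [Pi.add_apply, Pi.smul_apply, smul_eq_mul]
  rw [Lap_mul (contDiff_pot 1 M₁) (contDiff_pot 1 M₂), Lap_mul (contDiff_pot 1 ((-I) • M₁)) (contDiff_pot 1 ((-I) • M₂)),
    congrFun (Lap_pot hN 1 M₁) Q, congrFun (Lap_pot hN 1 M₂) Q, congrFun (Lap_pot hN 1 ((-I) • M₁)) Q,
    congrFun (Lap_pot hN 1 ((-I) • M₂)) Q, Gam_pot_pot hN, Gam_pot_negI_negI hN]
  simp only [pot, one_mul, re_trace_mul_negI_smul]
  have e1 : (M₁ * Q * M₂ * Q).trace.re = (Q * M₁ * Q * M₂).trace.re := by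
    rw [trace_mul_comm (M₁ * Q * M₂) Q]
    simp only [Matrix.mul_assoc]
  have e2 : ∀ M : Matrix (Fin N) (Fin N) ℂ, (M * Q).trace = (Q * M).trace := fun M => trace_mul_comm _ _
  rw [e1, e2 M₁, e2 M₂, mul_re]
  ring

/-- **Casimir action on the mixed product**: `Δ Re(tr(Q M₁) conj tr(Q M₂)) = −2N Re(tr(Q M₁) conj tr(Q M₂)) + 2 Re tr(M₁ Q Qᴴ M₂ᴴ)`
(adjoint Casimir `2N`; on `SU(N)` the last term is the constant `2 Re tr(M₁ M₂ᴴ)`). [folklore] -/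
theorem Lap_reTrProdConj (hN : N ≠ 0) (M₁ M₂ : Matrix (Fin N) (Fin N) ℂ) :
    Lap (fun Q : Matrix (Fin N) (Fin N) ℂ => ((Q * M₁).trace * (starRingEnd ℂ) (Q * M₂).trace).re) = fun Q =>
      -(2 * (N : ℝ) * ((Q * M₁).trace * (starRingEnd ℂ) (Q * M₂).trace).re) + 2 * (M₁ * Q * (M₂ * Q)ᴴ).trace.re := by
  have hA : ContDiff ℝ ∞ (pot 1 M₁ * pot 1 M₂) := (contDiff_pot 1 M₁).mul (contDiff_pot 1 M₂)
  have hB : ContDiff ℝ ∞ (pot 1 ((-I) • M₁) * pot 1 ((-I) • M₂)) := (contDiff_pot 1 _).mul (contDiff_pot 1 _)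
  rw [reTrProdConj_eq, Lap_add hA hB]
  funext Q
  simp only [Pi.add_apply]
  rw [Lap_mul (contDiff_pot 1 M₁) (contDiff_pot 1 M₂), Lap_mul (contDiff_pot 1 ((-I) • M₁)) (contDiff_pot 1 ((-I) • M₂)),
    congrFun (Lap_pot hN 1 M₁) Q, congrFun (Lap_pot hN 1 M₂) Q, congrFun (Lap_pot hN 1 ((-I) • M₁)) Q,
    congrFun (Lap_pot hN 1 ((-I) • M₂)) Q, Gam_pot_pot hN, Gam_pot_negI_negI hN]
  simp only [pot, one_mul, re_trace_mul_negI_smul]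
  have e2 : ∀ M : Matrix (Fin N) (Fin N) ℂ, (M * Q).trace = (Q * M).trace := fun M => trace_mul_comm _ _
  rw [e2 M₁, e2 M₂]
  have hN' : (N : ℝ) ≠ 0 := by exact_mod_cast hN
  simp only [mul_re, conj_re, conj_im]
  field_simp
  ring

/-! ### The second-order Poisson identity on `SU(N)` -/

/-- **THE SECOND-ORDER POISSON IDENTITY.**  For `N ≥ 3` and all `B, Δ ∈ M_N(ℂ)`, on `SU(N)`:
`Δ_LB ψ₂ + N · Γ(Re tr(· B), Re tr(· Δ)) = ((N − 1/N)/2) · Re tr(B Δᴴ)` (a constant), where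
`ψ₂(Q) = −κ_w Re tr(Q Δ Q B) + κ_t Re(tr(QB) tr(QΔ)) − (1/(4N)) Re(tr(QB) conj tr(QΔ))`,
`κ_w = N²/(4(N²−4))`, `κ_t = N/(2(N²−4))`.  With `S = N Re tr(· B)` (so `Γ(S, u) = N Γ(Re tr(· B), u)`), `u = Re tr(· Δ)`
and the tree's `u = (Γ(S,u) − L_S u)/(N − 1/N)` this says `u = (−L_S(u + ψ₂) + N Γ(Re tr(· B), ψ₂) + const)/(N − 1/N)`:
the Poisson equation for the linear observable is solved to second order in closed form, with a cubic remainder.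
[folklore] -/
theorem lap_psiTwo_add_gam (hN : 3 ≤ N) (B Δ : Matrix (Fin N) (Fin N) ℂ) (g : SUN N) :
    Lap (fun Q : Matrix (Fin N) (Fin N) ℂ =>
        -((N : ℝ) ^ 2 / (4 * ((N : ℝ) ^ 2 - 4))) * (Q * Δ * Q * B).trace.re
          + ((N : ℝ) / (2 * ((N : ℝ) ^ 2 - 4))) * ((Q * B).trace * (Q * Δ).trace).re
          - (1 / (4 * (N : ℝ))) * ((Q * B).trace * (starRingEnd ℂ) (Q * Δ).trace).re) g
      + N * Gam (pot 1 B) (pot 1 Δ) g = (((N : ℝ) - 1 / N) / 2) * (B * Δᴴ).trace.re := by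
  have hN0 : N ≠ 0 := by omega
  have hNr : (N : ℝ) ≠ 0 := by exact_mod_cast hN0
  have h3 : (3 : ℝ) ≤ N := by exact_mod_cast hN
  have hN4 : (N : ℝ) ^ 2 - 4 ≠ 0 := by nlinarith
  set κw : ℝ := (N : ℝ) ^ 2 / (4 * ((N : ℝ) ^ 2 - 4)) with hκw
  set κt : ℝ := (N : ℝ) / (2 * ((N : ℝ) ^ 2 - 4)) with hκt
  set c : ℝ := 1 / (4 * (N : ℝ)) with hc
  have hdec : (fun Q : Matrix (Fin N) (Fin N) ℂ =>
        -κw * (Q * Δ * Q * B).trace.re + κt * ((Q * B).trace * (Q * Δ).trace).re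
          - c * ((Q * B).trace * (starRingEnd ℂ) (Q * Δ).trace).re) =
      (-κw) • (fun Q : Matrix (Fin N) (Fin N) ℂ => (Q * Δ * Q * B).trace.re)
        + (κt • (fun Q : Matrix (Fin N) (Fin N) ℂ => ((Q * B).trace * (Q * Δ).trace).re)
          + (-c) • fun Q : Matrix (Fin N) (Fin N) ℂ => ((Q * B).trace * (starRingEnd ℂ) (Q * Δ).trace).re) := by
    funext Q; simp only [Pi.add_apply, Pi.smul_apply, smul_eq_mul]; ring
  have h1 : ContDiff ℝ ∞ ((-κw) • fun Q : Matrix (Fin N) (Fin N) ℂ => (Q * Δ * Q * B).trace.re) := by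
    have h := (contDiff_reTrQuad Δ B).const_smul (-κw); exact h
  have h2 : ContDiff ℝ ∞ (κt • fun Q : Matrix (Fin N) (Fin N) ℂ => ((Q * B).trace * (Q * Δ).trace).re) := by
    have h := (contDiff_reTrProd B Δ).const_smul κt; exact h
  have h3 : ContDiff ℝ ∞ ((-c) • fun Q : Matrix (Fin N) (Fin N) ℂ => ((Q * B).trace * (starRingEnd ℂ) (Q * Δ).trace).re) := by
    have h := (contDiff_reTrProdConj B Δ).const_smul (-c); exact h
  have h23 : ContDiff ℝ ∞ ((κt • fun Q : Matrix (Fin N) (Fin N) ℂ => ((Q * B).trace * (Q * Δ).trace).re)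
      + (-c) • fun Q : Matrix (Fin N) (Fin N) ℂ => ((Q * B).trace * (starRingEnd ℂ) (Q * Δ).trace).re) := h2.add h3
  rw [hdec, Lap_add h1 h23, Lap_add h2 h3, Lap_smul _ (contDiff_reTrQuad Δ B), Lap_smul _ (contDiff_reTrProd B Δ),
    Lap_smul _ (contDiff_reTrProdConj B Δ), Lap_reTrQuad hN0, Lap_reTrProd hN0, Lap_reTrProdConj hN0]
  simp only [Pi.add_apply, Pi.smul_apply, smul_eq_mul]
  rw [Gam_pot_pot_su hN0, mul_su_mul_conjTranspose]
  -- the trace atoms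
  set g' : Matrix (Fin N) (Fin N) ℂ := (g : Matrix (Fin N) (Fin N) ℂ) with hg'
  have e2 : (B * g' * Δ * g').trace.re = (g' * Δ * g' * B).trace.re := by
    rw [show B * g' * Δ * g' = B * (g' * Δ * g') by simp only [Matrix.mul_assoc], trace_mul_comm]
  have e2' : (g' * B * g' * Δ).trace.re = (g' * Δ * g' * B).trace.re := by
    rw [show g' * B * g' * Δ = (g' * B) * (g' * Δ) by simp only [Matrix.mul_assoc], trace_mul_comm]
    simp only [Matrix.mul_assoc]
  have e3 : (B * g').trace = (g' * B).trace := trace_mul_comm _ _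
  have e4 : (Δ * g').trace = (g' * Δ).trace := trace_mul_comm _ _
  rw [e2, e2', e3, e4]
  simp only [mul_re, conj_re, conj_im, one_mul, hκw, hκt, hc]
  field_simp
  ring

end Calc

end Summit.Ventures.YMGap.OneLinkEigen
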